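import Summits.BirchSwinnertonDyer.Uniform.UI.O2
import Summits.BirchSwinnertonDyer.Uniform.UI.O2SigmaValuationLemmas
import Literature.NumberTheory.EllipticCurves.SteinWuthrich2013.NonsplitIntegralIsoProofs
import Literature.NumberTheory.EllipticCurves.PadicFormalLogOrder
import Literature.NumberTheory.EllipticCurves.CanonicalPAdicHeightThetaProofs
import Literature.NumberTheory.EllipticCurves.WeierstrassFieldOfModuliProofs
import Summits.BirchSwinnertonDyer.Rank1Residual.O5.HeegnerLogTransportThreeLogUnitCertCore
import HarnessLib

/-!
# Uniform/UI/O2 — the VALUATION of the Tate–sigma value: `‖Σ²_E(P)‖_p = ‖z(P)‖_p²` (test P3 is a theorem)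

HONEST FRAMING (cell `bsd-uniform`, seat `ui-o2`, gen 5): THEOREMS ONLY about the OBJECT of the conjecture
typed in `Uniform/UI/O2.lean` (`tateSigmaValueSq`, the `3`-adic number `Σ²_E(P) = C²σ_q(u(P))²` whose
irrationality `TateSigmaIrrationalAtThree` asserts); no definition, no named fact, no `sorry`; everything is
UNCONDITIONAL (the conjecture is assumed nowhere); nothing here proves BSD for any curve, books anything or
moves a census mark, and the conjecture stays OPEN (proof side R1/R2 of the write-up untouched).

What this file adds. The evidence plan of `HOME/ui/O2-CONJECTURE.md` §4 pre-registered (2026-08-22) the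
STRUCTURE prediction **P3: `v₃(Σ²(Q)) = 2·v₃(z(Q))` exactly ("unit sigma factor")**, so far OBSERVED only
(24/24 values of the first σ-screen; every row of the gen-3 registers, P3′: 2 020 rows, P3″: 4 054
generators). It is a THEOREM, at every odd prime and without the conjecture's side conditions:

* `norm_tateSigmaValueSq_eq` — for `W/ℚ` globally minimal with multiplicative reduction at an odd prime
  `p`, ANY `q ∈ ℚ_p` with `‖q‖_p < 1` and any rational affine point `P = (x, y)` with `‖x‖_p > 1`:
  **`‖Σ²_W(P)‖_p = ‖z(P)‖_p²`** (`z = −x/y`) `= ‖x(P)‖_p⁻¹` (`norm_tateSigmaValueSq_eq_inv_norm_x`);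
  valuation form `valuation_tateSigmaValueSq_eq`; and **`valuation_tateSigmaValueSq_three`** = P3 under
  literally the binders of `TateSigmaIrrationalAtThree` (only `Mult W 3`, `‖q‖ < 1`, `‖x‖₃ > 1` are used).
* MECHANISM (why the transcendental scale is invisible): in the tree's transcription
  `Σ² = C² · 2(ch(L) − 1) · Π` with `L = log_E(z)²/C²`; `Π` is a unit and `‖2(ch(L) − 1)‖_p = ‖L‖_p`
  (lemma file `O2SigmaValuationLemmas`, §3–§4), so **`C²` CANCELS**: `‖Σ²‖ = ‖C²‖·‖L‖ = ‖log_E(z)‖² = ‖z‖²`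
  (§5 = `‖log_E(z)‖_p = ‖z‖_p` on `pℤ_p`, `p` odd: the tree's
  `Rank1Residual.O5.HeegnerLogTransport.norm_padicFormalLog_eq_of_norm_le_inv`, AEC IV.6.4). The only input about `C² = c₆(E_q)c₄(W)/(c₄(E_q)c₆(W))` is `‖C²‖_p ≥ 1` (§2 here:
  `‖c₄(W)‖_p = 1` IS multiplicative reduction — tree `norm_c₄_eq_one_of_hasMultiplicativeReductionAtPrime`;
  `c₄(E_q) = E₄(q)`, `c₆(E_q) = −E₆(q)` are units; `c₆(W)` is a non-zero `p`-adic integer because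
  `‖j(W)‖_p > 1` forbids `j = 1728`), which keeps `L` in the disc `‖L‖_p ≤ p⁻²` where `ch` is controlled.
* CONSEQUENCES (§6–§7): `tateSigmaValueSq_ne_zero` — `Σ²_W(P) ≠ 0` unconditionally (gen 2 derived it from
  the conjecture, `0 ∈ ℚ`); `norm_ratCast_eq_of_tateSigmaValueSq_eq` — a rational value `r = Σ²(P)` would
  have `|r|_p = ‖x(P)‖_p⁻¹` FORCED, so the conjecture constrains the UNIT PART only;
  `norm_tateSigmaValueSq_div_den_eq_one` — **`U(P) := Σ²_W(P)/den x(P)` is a `p`-adic unit**;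
  `heightFourOneCoord_eq_neg_padicLog_div_den` — **SW's height (4.1) is `ĥ(P) = −log_p U(P)`** (tree fact
  `padicLog_mul_holds`); `tateSigmaIrrationalAtThree_iff_unit_irrational` — C4 ⟺ `U(P) ∉ ℚ` on the same
  binders. So the σ-screens P1/P1′/P1″ (δ-statistic on the unit part of `Σ²`, normalised by `3^{−2v₃(z)}`)
  tested exactly the conjecture's content, and P3 leaves the falsifiable ledger of §4 to become kernel fact.

Not here: the irrationality itself (R1/R2 of the write-up stay OPEN); the split-prime dictionary
(`heightSplitCoord`); `p = 2` (the disc estimate of the lemma file fails there).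

References: [SteinWuthrich2013] §4.1 eq. (4.1), §4.2; [SilvermanAEC2009] VII.2.2, VII.5.1(b);
[SilvermanATAEC1994] Thm. V.3.1; [Iwasawa1972PadicL] §4.4; `HOME/ui/O2-CONJECTURE.md` §4 (P3), §8 (P3′, P3″),
§10 (this generation's record).
-/

noncomputable section

open scoped Classical Nat
open Filter Topology IsUltrametricDist PowerSeries
open WeierstrassCurve Literature.NumberTheory.EllipticCurves
open Literature.NumberTheory.EllipticCurves.SteinWuthrich2013
open Literature.NumberTheory.EllipticCurves.TateCurve
open Literature.NumberTheory.EllipticCurves.Rank1Residual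

namespace Summit.BirchSwinnertonDyer.Uniform.UI.O2

variable {p : ℕ} [hp : Fact p.Prime]

/-! ### §2 The uniformisation scale `C²` is a `p`-adic unit or larger at a multiplicative prime -/

/-- `‖E₆(q)‖_p = 1` for `‖q‖_p < 1` (`E₆(q) = 1 − 504 s₅(q)`, `‖s₅(q)‖ ≤ ‖q‖`).
[cite: SilvermanATAEC1994, Ch. V §1 (1.1)] -/
theorem norm_tateE6_eq_one {q : ℚ_[p]} (hq : ‖q‖ < 1) : ‖tateE6 q‖ = 1 := by
  rw [tateE6, sub_eq_add_neg]
  refine norm_one_add_eq_one_of_norm_lt_one ?_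
  have hS : ‖tateS 5 q‖ < 1 := (norm_tateS_le (k := 5) hq.le).trans_lt hq
  have h504 : ‖(504 : ℚ_[p])‖ ≤ 1 := by
    have h : ((504 : ℤ) : ℚ_[p]) = 504 := by norm_cast
    rw [← h]
    exact Padic.norm_int_le_one 504
  rw [norm_neg, norm_mul]
  exact mul_lt_one_of_nonneg_of_lt_one_right h504 (norm_nonneg _) hS

/-- `‖c₄(E_q)‖_p = 1` for `‖q‖_p < 1` (`c₄(E_q) = E₄(q)`). [cite: SilvermanATAEC1994, Thm. V.3.1 (b)] -/
theorem norm_c₄_tateCurve_eq_one {q : ℚ_[p]} (hq : ‖q‖ < 1) : ‖(tateCurve q).c₄‖ = 1 := by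
  rw [tateCurve_c₄]
  exact norm_tateE4_eq_one hq

/-- `‖c₆(E_q)‖_p = 1` for `‖q‖_p < 1` (`c₆(E_q) = −E₆(q)`). [cite: SilvermanATAEC1994, Thm. V.3.1 (b)] -/
theorem norm_c₆_tateCurve_eq_one {q : ℚ_[p]} (hq : ‖q‖ < 1) : ‖(tateCurve q).c₆‖ = 1 := by
  have h12 : (12 : ℚ_[p]) ≠ 0 := by
    have h : ((12 : ℕ) : ℚ_[p]) = 12 := by norm_cast
    rw [← h, Nat.cast_ne_zero]
    norm_num
  rw [tateCurve_c₆ h12, norm_neg]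
  exact norm_tateE6_eq_one hq

variable {W : WeierstrassCurve ℚ}

/-- `‖c₆(W)‖_p ≤ 1` for a globally minimal (hence `ℤ`-integral) `W/ℚ`. [folklore] -/
theorem norm_c₆_le_one [W.IsGloballyMinimal] : ‖(W.c₆ : ℚ_[p])‖ ≤ 1 := by
  obtain ⟨r, hr⟩ : ∃ r : ℤ_[p], (r : ℚ_[p]) = (W.baseChange ℚ_[p]).c₆ :=
    ⟨_, integralModel_c₆_eq ℤ_[p] (W.baseChange ℚ_[p])⟩
  -- `c₆(W ⊗ ℚ_p) = c₆(W)` (tree: `Rank1Residual.Additive.baseChange_padic_c₆`, not imported)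
  have hc₆ : (W.baseChange ℚ_[p]).c₆ = (W.c₆ : ℚ_[p]) :=
    (map_c₆ W (algebraMap ℚ ℚ_[p])).trans (eq_ratCast _ _)
  rw [← hc₆, ← hr, ← PadicInt.norm_def]
  exact PadicInt.norm_le_one r

/-- At a multiplicative prime `c₆(W) ≠ 0`: `‖j(W)‖_p > 1` (tree theorem
`one_lt_norm_j_of_hasMultiplicativeReductionAtPrime`) rules out `j = 1728`, and `j ≠ 1728 ⇒ c₆ ≠ 0`.
[cite: SilvermanAEC2009, Prop. VII.5.1(b)] -/
theorem c₆_ne_zero_of_mult [W.IsElliptic] (hW : Mult W p) : (W.c₆ : ℚ_[p]) ≠ 0 := by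
  have hj := one_lt_norm_j_of_hasMultiplicativeReductionAtPrime (W := W) (p := p) hW
  have h1728 : W.j ≠ 1728 := by
    intro e
    rw [e] at hj
    have h : ‖((1728 : ℚ) : ℚ_[p])‖ ≤ 1 := by
      have : ((1728 : ℚ) : ℚ_[p]) = ((1728 : ℤ) : ℚ_[p]) := by norm_cast
      rw [this]
      exact Padic.norm_int_le_one 1728
    exact absurd hj (not_lt.mpr h)
  exact_mod_cast WeierstrassCurve.c₆_ne_zero_of_j_ne W h1728

/-- **`‖C²‖_p ≥ 1` and `C² ≠ 0` at a multiplicative prime.** For `W/ℚ` globally minimal with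
multiplicative reduction at `p` and any `‖q‖_p < 1`:
`C² = c₆(E_q)·c₄(W)/(c₄(E_q)·c₆(W))` has `‖c₆(E_q)‖ = ‖c₄(E_q)‖ = ‖c₄(W)‖_p = 1` (tree theorem
`norm_c₄_eq_one_of_hasMultiplicativeReductionAtPrime`) and `0 < ‖c₆(W)‖_p ≤ 1`, so `‖C²‖_p = ‖c₆(W)‖_p⁻¹ ≥ 1`.
[cite: SteinWuthrich2013, §4.2] -/
theorem one_le_norm_uniformisationScaleSq [W.IsElliptic] [W.IsGloballyMinimal] (hW : Mult W p)
    {q : ℚ_[p]} (hq : ‖q‖ < 1) :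
    1 ≤ ‖uniformisationScaleSq W p q‖ ∧ uniformisationScaleSq W p q ≠ 0 := by
  have h4 : ‖(W.c₄ : ℚ_[p])‖ = 1 := norm_c₄_eq_one_of_hasMultiplicativeReductionAtPrime hW
  have h6 : (W.c₆ : ℚ_[p]) ≠ 0 := c₆_ne_zero_of_mult hW
  have h6' : ‖(W.c₆ : ℚ_[p])‖ ≤ 1 := norm_c₆_le_one
  have h6pos : 0 < ‖(W.c₆ : ℚ_[p])‖ := norm_pos_iff.mpr h6
  have hE4 : ‖(tateCurve q).c₄‖ = 1 := norm_c₄_tateCurve_eq_one hq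
  have hE6 : ‖(tateCurve q).c₆‖ = 1 := norm_c₆_tateCurve_eq_one hq
  have hc₄ : (W.baseChange ℚ_[p]).c₄ = (W.c₄ : ℚ_[p]) :=
    (map_c₄ W (algebraMap ℚ ℚ_[p])).trans (eq_ratCast _ _)
  have hc₆ : (W.baseChange ℚ_[p]).c₆ = (W.c₆ : ℚ_[p]) :=
    (map_c₆ W (algebraMap ℚ ℚ_[p])).trans (eq_ratCast _ _)
  have hnorm : ‖uniformisationScaleSq W p q‖ = ‖(W.c₆ : ℚ_[p])‖⁻¹ := by
    unfold uniformisationScaleSq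
    rw [hc₄, hc₆, norm_div, norm_mul, norm_mul, hE6, h4, hE4, one_mul, one_mul, one_div]
  refine ⟨?_, ?_⟩
  · rw [hnorm]
    exact (one_le_inv₀ h6pos).mpr h6'
  · rw [← norm_pos_iff, hnorm]
    exact inv_pos.mpr h6pos

/-! ### §6 The valuation of the Tate–sigma value: `‖Σ²_E(P)‖_p = ‖z(P)‖_p² = ‖x(P)‖_p⁻¹` -/

/-- For a rational affine point `(x, y)` of a globally minimal `W` with `‖x‖_p > 1` (i.e. in the kernel of
reduction `E₁(ℚ_p)`): `z = −x/y` satisfies `‖z‖_p ≤ p⁻¹` and `‖z‖_p² = ‖x‖_p⁻¹` (AEC VII.2.2: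
`v(x) = −2k`, `v(y) = −3k`; tree `norm_formalParameter_sq` + discreteness of `‖·‖_p`).
[cite: SilvermanAEC2009, VII.2.2] -/
theorem norm_neg_div_of_one_lt_norm [W.IsGloballyMinimal] {x y : ℚ} (hxy : W.toAffine.Nonsingular x y)
    (hx : 1 < ‖(x : ℚ_[p])‖) :
    ‖(-(x : ℚ_[p]) / y)‖ ≤ (p : ℝ)⁻¹ ∧ ‖(-(x : ℚ_[p]) / y)‖ ^ 2 = ‖(x : ℚ_[p])‖⁻¹ := by
  have heq : (W.baseChange ℚ_[p]).toAffine.Equation (x : ℚ_[p]) (y : ℚ_[p]) :=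
    (nonsingular_ratCast (p := p) hxy).left
  have hsq := (W.baseChange ℚ_[p]).norm_formalParameter_sq heq hx
  have hlt : ‖(-(x : ℚ_[p]) / y)‖ < 1 := by
    have h1 : ‖(-(x : ℚ_[p]) / y)‖ ^ 2 < 1 := by rw [hsq]; exact inv_lt_one_of_one_lt₀ hx
    exact (pow_lt_one_iff_of_nonneg (norm_nonneg _) two_ne_zero).mp h1
  have hle := (Padic.norm_le_pow_iff_norm_lt_pow_add_one (-(x : ℚ_[p]) / (y : ℚ_[p])) (-1)).2
    (by rw [neg_add_cancel, zpow_zero]; exact hlt)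
  rw [zpow_neg_one] at hle
  exact ⟨hle, hsq⟩

/-- **THE VALUATION THEOREM.** For `W/ℚ` globally minimal with multiplicative reduction at an odd prime
`p`, ANY `q ∈ ℚ_p` with `‖q‖_p < 1`, and any rational affine point `P = (x, y)` with `‖x‖_p > 1`:
`‖Σ²_W(P)‖_p = ‖z(P)‖_p²`, `z(P) = −x/y`, where `Σ² = C²·σ_q(u(P))²` is the Tate–sigma value of
`Uniform/UI/O2.lean` (`tateSigmaValueSq`). Mechanism: `σ_q² = 2(ch(L) − 1)·Π` with `Π` a unit (§4),
`L = log_E(z)²/C²`, and `C²·2(ch(L) − 1)` has the norm of `C²·L = log_E(z)²` (§3: the scale `C²`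
CANCELS — whatever its transcendence), `‖C²‖ ≥ 1` (§2) keeps `L` in the disc `‖L‖ ≤ p⁻²`, and
`‖log_E(z)‖ = ‖z‖` (§5, tree lemma of the O5 cell). Unconditional; no `q ≠ 0`, `j(q) = j(W)`, non-torsion or reduction
hypothesis on `P` beyond `‖x‖_p > 1` is needed. [cite: SteinWuthrich2013, §4.2] -/
theorem norm_tateSigmaValueSq_eq (hp2 : p ≠ 2) [W.IsElliptic] [W.IsGloballyMinimal] (hW : Mult W p)
    {q : ℚ_[p]} (hq : ‖q‖ < 1) {x y : ℚ} (hxy : W.toAffine.Nonsingular x y)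
    (hx : 1 < ‖(x : ℚ_[p])‖) :
    ‖tateSigmaValueSq W p q x y‖ = ‖(-(x : ℚ_[p]) / y)‖ ^ 2 := by
  obtain ⟨hz, -⟩ := norm_neg_div_of_one_lt_norm (p := p) hxy hx
  obtain ⟨hC1, hC0⟩ := one_le_norm_uniformisationScaleSq hW hq
  have hCpos : 0 < ‖uniformisationScaleSq W p q‖ := norm_pos_iff.mpr hC0
  have hℓz : ‖(W.baseChange ℚ_[p]).padicFormalLog (-(x : ℚ_[p]) / y)‖ = ‖(-(x : ℚ_[p]) / y)‖ :=
    Summit.BirchSwinnertonDyer.Rank1Residual.O5.HeegnerLogTransport.norm_padicFormalLog_eq_of_norm_le_inv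
      (W.baseChange ℚ_[p]) hp2 hz
  have hL : logUnitParamSq W p q x y =
      (W.baseChange ℚ_[p]).padicFormalLog (-(x : ℚ_[p]) / y) ^ 2 / uniformisationScaleSq W p q := rfl
  have hLnorm : ‖logUnitParamSq W p q x y‖ = ‖(-(x : ℚ_[p]) / y)‖ ^ 2 / ‖uniformisationScaleSq W p q‖ := by
    rw [hL, norm_div, norm_pow, hℓz]
  have hLle : ‖logUnitParamSq W p q x y‖ ≤ ((p : ℝ)⁻¹) ^ 2 := by
    rw [hLnorm]
    calc ‖(-(x : ℚ_[p]) / y)‖ ^ 2 / ‖uniformisationScaleSq W p q‖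
        ≤ ‖(-(x : ℚ_[p]) / y)‖ ^ 2 / 1 := div_le_div_of_nonneg_left (by positivity) one_pos hC1
      _ ≤ ((p : ℝ)⁻¹) ^ 2 := by rw [div_one]; exact pow_le_pow_left₀ (norm_nonneg _) hz 2
  have hc : ‖coshOfSq (logUnitParamSq W p q x y)‖ ≤ 1 := (norm_coshOfSq_eq_one hp2 hLle).le
  unfold tateSigmaValueSq
  rw [norm_mul, norm_tateSigmaSq_eq hq hc, norm_two_mul_coshOfSq_sub_one hp2 hLle, hLnorm]
  field_simp

/-- `‖Σ²_W(P)‖_p = ‖x(P)‖_p⁻¹` — the same theorem through `‖z(P)‖² = ‖x(P)‖⁻¹`; in valuations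
`v_p(Σ²(P)) = −v_p(x(P)) = 2k` where `p^{2k} ‖ den x(P)`. [cite: SteinWuthrich2013, §4.2] -/
theorem norm_tateSigmaValueSq_eq_inv_norm_x (hp2 : p ≠ 2) [W.IsElliptic] [W.IsGloballyMinimal]
    (hW : Mult W p) {q : ℚ_[p]} (hq : ‖q‖ < 1) {x y : ℚ} (hxy : W.toAffine.Nonsingular x y)
    (hx : 1 < ‖(x : ℚ_[p])‖) :
    ‖tateSigmaValueSq W p q x y‖ = ‖(x : ℚ_[p])‖⁻¹ := by
  rw [norm_tateSigmaValueSq_eq hp2 hW hq hxy hx, (norm_neg_div_of_one_lt_norm (p := p) hxy hx).2]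

/-- **`Σ²_W(P) ≠ 0`**, unconditionally, under the same hypotheses (its norm is `‖x(P)‖_p⁻¹ > 0`).
Earlier O2 files had to derive this from the conjecture (`0 ∈ ℚ`). [cite: SteinWuthrich2013, §4.2] -/
theorem tateSigmaValueSq_ne_zero (hp2 : p ≠ 2) [W.IsElliptic] [W.IsGloballyMinimal] (hW : Mult W p)
    {q : ℚ_[p]} (hq : ‖q‖ < 1) {x y : ℚ} (hxy : W.toAffine.Nonsingular x y)
    (hx : 1 < ‖(x : ℚ_[p])‖) : tateSigmaValueSq W p q x y ≠ 0 := by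
  rw [← norm_pos_iff, norm_tateSigmaValueSq_eq_inv_norm_x hp2 hW hq hxy hx]
  exact inv_pos.mpr (one_pos.trans hx)

/-- **Valuation form**: `v_p(Σ²_W(P)) = 2·v_p(z(P))` (`Padic.valuation`; both sides are genuine
valuations since `Σ²(P) ≠ 0 ≠ z(P)`). [cite: SteinWuthrich2013, §4.2] -/
theorem valuation_tateSigmaValueSq_eq (hp2 : p ≠ 2) [W.IsElliptic] [W.IsGloballyMinimal]
    (hW : Mult W p) {q : ℚ_[p]} (hq : ‖q‖ < 1) {x y : ℚ} (hxy : W.toAffine.Nonsingular x y)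
    (hx : 1 < ‖(x : ℚ_[p])‖) :
    (tateSigmaValueSq W p q x y).valuation = 2 * (-(x : ℚ_[p]) / y).valuation := by
  have hp0 : (0 : ℝ) < p := by exact_mod_cast hp.out.pos
  have hp1 : (p : ℝ) ≠ 1 := by exact_mod_cast hp.out.one_lt.ne'
  have hS0 := tateSigmaValueSq_ne_zero hp2 hW hq hxy hx
  have hz0 : (-(x : ℚ_[p]) / (y : ℚ_[p])) ≠ 0 := by
    intro h0
    have h2 := (norm_neg_div_of_one_lt_norm (p := p) hxy hx).2
    rw [h0, norm_zero, zero_pow two_ne_zero] at h2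
    exact absurd h2.symm (inv_pos.mpr (one_pos.trans hx)).ne'
  have h := norm_tateSigmaValueSq_eq hp2 hW hq hxy hx
  rw [Padic.norm_eq_zpow_neg_valuation hS0, Padic.norm_eq_zpow_neg_valuation hz0, ← zpow_natCast,
    ← zpow_mul] at h
  have hinj := zpow_right_injective₀ hp0 hp1 h
  push_cast at hinj
  linarith

/-- **Test P3 of the evidence plan (`HOME/ui/O2-CONJECTURE.md` §4: "`v₃(Σ²(Q)) = 2·v₃(z(Q))` exactly —
unit sigma factor", pre-registered 2026-08-22, observed on 24 + 2 020 + 4 054 screened values) is a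
THEOREM**, under exactly the binders of `TateSigmaIrrationalAtThree` (of which only `Mult W 3`,
`‖q‖ < 1` and `‖x‖₃ > 1` from admissibility are used). [cite: SteinWuthrich2013, §4.2] -/
theorem valuation_tateSigmaValueSq_three [W.IsElliptic] [W.IsGloballyMinimal] (hW : Mult W 3)
    {q : ℚ_[3]} (hq : ‖q‖ < 1) {x y : ℚ} (h : W.toAffine.Nonsingular x y)
    (hP : W.IsAdmissible 3 (.some x y h)) :
    (tateSigmaValueSq W 3 q x y).valuation = 2 * (-(x : ℚ_[3]) / y).valuation :=
  valuation_tateSigmaValueSq_eq (by decide) hW hq h hP.2.1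

/-- **What a rational value would have to look like.** If `Σ²_W(P) = r ∈ ℚ` (the event the conjecture
`TateSigmaIrrationalAtThree` excludes at `p = 3`), then `|r|_p = ‖x(P)‖_p⁻¹`: the `p`-adic valuation of
a hypothetical rational value is FORCED, so the conjecture is a statement about the UNIT PART of `Σ²`
alone — the normalisation used by the pre-registered σ-screens P1/P1′/P1″. [cite: SteinWuthrich2013, §4.2] -/
theorem norm_ratCast_eq_of_tateSigmaValueSq_eq (hp2 : p ≠ 2) [W.IsElliptic] [W.IsGloballyMinimal]
    (hW : Mult W p) {q : ℚ_[p]} (hq : ‖q‖ < 1) {x y : ℚ} (hxy : W.toAffine.Nonsingular x y)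
    (hx : 1 < ‖(x : ℚ_[p])‖) {r : ℚ} (hr : tateSigmaValueSq W p q x y = (r : ℚ_[p])) :
    ‖(r : ℚ_[p])‖ = ‖(x : ℚ_[p])‖⁻¹ := by
  rw [← hr]; exact norm_tateSigmaValueSq_eq_inv_norm_x hp2 hW hq hxy hx

/-! ### §7 The unit `U(P) = Σ²_W(P)/den x(P)` and SW's height (4.1) -/

/-- For `x ∈ ℚ` with `‖x‖_p > 1`: `‖den x‖_p = ‖x‖_p⁻¹` (`p ∣ den x`, so `p ∤ num x` by coprimality,
so `‖num x‖_p = 1`). [folklore] -/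
theorem norm_den_eq_inv_norm {x : ℚ} (hx : 1 < ‖(x : ℚ_[p])‖) :
    ‖((x.den : ℚ) : ℚ_[p])‖ = ‖(x : ℚ_[p])‖⁻¹ := by
  have hden : p ∣ x.den := by
    by_contra h
    exact absurd (Padic.norm_rat_le_one h) (not_le.mpr hx)
  have hnum : ¬ (p : ℤ) ∣ x.num := by
    intro h
    have h1 : p ∣ x.num.natAbs := Int.natCast_dvd.mp h
    have h2 : p ∣ Nat.gcd x.num.natAbs x.den := Nat.dvd_gcd h1 hden
    rw [x.reduced] at h2
    exact hp.out.one_lt.ne' (Nat.dvd_one.mp h2)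
  have hnum1 : ‖(x.num : ℚ_[p])‖ = 1 :=
    le_antisymm (Padic.norm_int_le_one _) (not_lt.mp (mt Padic.norm_intCast_lt_one_iff.mp hnum))
  have hden0 : ‖(x.den : ℚ_[p])‖ ≠ 0 := by
    rw [norm_ne_zero_iff]; exact_mod_cast x.den_nz
  have hcast : ((x.den : ℚ) : ℚ_[p]) = (x.den : ℚ_[p]) := by norm_cast
  have hx' : ‖(x : ℚ_[p])‖ = ‖(x.den : ℚ_[p])‖⁻¹ := by
    rw [Rat.cast_def x, norm_div, hnum1, one_div]
  rw [hcast, hx', inv_inv]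

/-- **`U(P) := Σ²_W(P)/den x(P)` is a `p`-adic UNIT** (`‖Σ²‖ = ‖x‖⁻¹ = ‖den x‖`): the "unit part of
`Σ²`" that the pre-registered σ-screens reconstruct is this canonical quotient, up to sign.
[cite: SteinWuthrich2013, §4.2] -/
theorem norm_tateSigmaValueSq_div_den_eq_one (hp2 : p ≠ 2) [W.IsElliptic] [W.IsGloballyMinimal]
    (hW : Mult W p) {q : ℚ_[p]} (hq : ‖q‖ < 1) {x y : ℚ} (hxy : W.toAffine.Nonsingular x y)
    (hx : 1 < ‖(x : ℚ_[p])‖) :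
    ‖tateSigmaValueSq W p q x y / ((x.den : ℚ) : ℚ_[p])‖ = 1 := by
  have hxpos : 0 < ‖(x : ℚ_[p])‖ := one_pos.trans hx
  rw [norm_div, norm_tateSigmaValueSq_eq_inv_norm_x hp2 hW hq hxy hx, norm_den_eq_inv_norm hx,
    div_self (inv_pos.mpr hxpos).ne']

/-- **SW's height (4.1) at a multiplicative prime is minus the Iwasawa logarithm of the unit `U(P)`:**
`ĥ(P) = log_p(den x(P)) − log_p Σ²_W(P) = −log_p(Σ²_W(P)/den x(P))` (`heightFourOneCoord`; tree fact
`padicLog_mul_holds`, Iwasawa 1972 §4.4). With §6 this says the height of the non-split locus is the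
logarithm of ONE explicit `p`-adic unit attached to the point. [cite: SteinWuthrich2013, §4.1 eq. (4.1) and §4.2] -/
theorem heightFourOneCoord_eq_neg_padicLog_div_den (hp2 : p ≠ 2) [W.IsElliptic] [W.IsGloballyMinimal]
    (hW : Mult W p) {q : ℚ_[p]} (hq : ‖q‖ < 1) {x y : ℚ} (hxy : W.toAffine.Nonsingular x y)
    (hx : 1 < ‖(x : ℚ_[p])‖) :
    heightFourOneCoord W p q x y =
      -padicLog p (tateSigmaValueSq W p q x y / ((x.den : ℚ) : ℚ_[p])) := by
  have hS0 := tateSigmaValueSq_ne_zero hp2 hW hq hxy hx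
  have hd0 : ((x.den : ℚ) : ℚ_[p]) ≠ 0 := by exact_mod_cast x.den_nz
  have hq0 : tateSigmaValueSq W p q x y / ((x.den : ℚ) : ℚ_[p]) ≠ 0 := div_ne_zero hS0 hd0
  have hmul := padicLog_mul_holds p hq0 hd0
  rw [div_mul_cancel₀ _ hd0] at hmul
  have h0 : heightFourOneCoord W p q x y =
      padicLog p ((x.den : ℚ) : ℚ_[p]) - padicLog p (tateSigmaValueSq W p q x y) := rfl
  rw [h0, hmul]
  ring

/-- **The conjecture is about `U(P)` only**: since `den x(P) ∈ ℚˣ`, `Σ²_W(P) ∉ ℚ ⟺ U(P) ∉ ℚ`; so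
`TateSigmaIrrationalAtThree` reads: for every curve multiplicative at `3` and every admissible point,
the `3`-adic unit `U(P)` whose Iwasawa logarithm is `−ĥ₃(P)` is irrational. (Pure bookkeeping; recorded
so that the write-up's "unit part" has a kernel referent.) [cite: SteinWuthrich2013, §4.2] -/
theorem tateSigmaIrrationalAtThree_iff_unit_irrational :
    TateSigmaIrrationalAtThree ↔
      ∀ (W : WeierstrassCurve ℚ) [W.IsElliptic] [W.IsGloballyMinimal], Mult W 3 →
        ∀ (q : ℚ_[3]), q ≠ 0 → ‖q‖ < 1 → tateJ q = (W.j : ℚ_[3]) →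
        ∀ (x y : ℚ) (h : W.toAffine.Nonsingular x y), W.IsAdmissible 3 (.some x y h) →
          ∀ r : ℚ, tateSigmaValueSq W 3 q x y / ((x.den : ℚ) : ℚ_[3]) ≠ (r : ℚ_[3]) := by
  have hden : ∀ x : ℚ, ((x.den : ℚ) : ℚ_[3]) ≠ 0 := fun x => by exact_mod_cast x.den_nz
  constructor
  · intro hC W _ _ hW q hq0 hq hj x y h hP r hr
    refine hC W hW q hq0 hq hj x y h hP (r * x.den) ?_
    rw [Rat.cast_mul, ← hr, div_mul_cancel₀ _ (hden x)]
  · intro hU W _ _ hW q hq0 hq hj x y h hP r hr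
    refine hU W hW q hq0 hq hj x y h hP (r / x.den) ?_
    rw [Rat.cast_div, ← hr]

end Summit.BirchSwinnertonDyer.Uniform.UI.O2

end
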